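import Summits.BirchSwinnertonDyer.Rank1Residual.AdditivePotMult.RankOneIndexCertificateOdd
import Literature.NumberTheory.EllipticCurves.Rank1Residual.Typed.CasselsLowerBound
import HarnessLib

/-!
# Rank ONE at an additive (indeed ANY bad) odd prime: the Heegner-index VALUATION plus a finite
# `Ш`-certificate — `BSD(E,p)` on the rows with `p ∣ #Ш_an(E)` (cell `b2b-bsdres`, sub-cell additive-p1, gen 12)

HONEST FRAMING (cell `b2b-bsdres`, run/shared/lean/b2b/bsd-rank1-residual/, verbatim in every
file): the goal of the cell is to DELETE the COMBINATION-SHAPED residual classes of the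
Birch–Swinnerton-Dyer formula for ALL analytic-rank `≤ 1` elliptic curves over `ℚ` — "full BSD
formula for every rank `≤ 1` curve in class `C`" assembled STRICTLY from published theorems — so
that the rank-`≤ 1` remainder becomes exactly the CONSTRUCTION-SHAPED classes, which are TYPED
(missing-input `Prop`s), NOT attempted. This is not "finishing BSD". Sub-cell additive-p1 is a
RESEARCH ROUTE on the construction-shaped classes X3♯(M) / X4(M) (additive, potentially
multiplicative `p`); no claim beyond the stated sub-classes; X3/X4 labels are UNCHANGED by this file;
NOTHING is booked here (a per-pair closure is the referee's ruling on the lane's certificates).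

THEOREMS ONLY (no definition, no named fact). PER PAIR, not a class theorem; class-agnostic.

WHY. Gen 10's exact index certificate (`RankOneIndexCertificateOdd.lean`, p238704) closes a rank-one
pair `(E, p)` with `ρ̄_{E,p}` onto from `p ∤ [E(K):ℤP]` ∧ `ord_p L(E^{d_K},1)/Ω = 0` ∧ `p ∤ ∏c_ℓ(E)`:
the UNIT case `ord_p #Ш(E)_an = 0`. Gen 11's `RankZeroShaCertificate.lean` (p243353) handled the
rank-ZERO rows with `p ∣ #Ш_an` (upper half in print + Cassels–Tate + a finite certificate
`p^{2k−1} ∣ #Ш`). This file is the rank-ONE analogue, needed by the lane-residue rank-one X4(M)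
pairs at `p = 3` with `#Ш_an(E) = 9` (19 beyond the window `N < 2·10⁴`, census-g12): there the
Gross–Zagier identity forces `p ∣ [E(K):ℤP]` at EVERY Heegner field, so no exact certificate exists.
The published inputs are the SAME as gen 10's (Kolyvagin's quantitative bound via McCallum 1991 §1
/ Gross 1991 — `p` odd, `ρ̄` onto, no hypothesis at `p` — `hB`; Gross–Zagier `hGZ`; Kolyvagin's
qualitative theorem `hKo`; GZK `hGZK`; modularity `hmod`) plus Cassels 1962 (`hCT`, the tree's
bsd.S18 `exists_casselsTate_pairing`):
* Kolyvagin: `ord_p #Ш(E/K) ≤ 2·ord_p [E(K):ℤP]`;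
* the bookkeeping identity (multr1-p2's `X11b.exists_shaAn_padicVal_eq_of_heegner`, JSW 2017 (eq:gz
  for K′)): `Ш(E/K)`, `Ш(E)` finite, `ord_p #Ш(E/K) = ord_p #Ш(E) + ord_p #Ш(Wd)` and
  `ord_p #Ш(E)_an + ord_p q_d + ord_p ∏c_ℓ(E) + 2·ord_p #Wd(ℚ)_tors = 2·ord_p [E(K):ℤP]`;
* so when the twist value is a unit (`ord_p q_d = 0`), `p ∤ ∏c_ℓ(E)` and (irreducibility) the twist
  has no rational `p`-torsion: `ord_p #Ш(E) + ord_p #Ш(Wd) ≤ ord_p #Ш(E)_an = 2·ord_p [E(K):ℤP]` —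
  the UPPER half for `E`; and when `ord_p [E(K):ℤP] ≤ k` and a certificate gives
  `p^{2k−1} ∣ #Ш(E/ℚ)`, Cassels–Tate squareness gives `2k ≤ ord_p #Ш(E)`, whence EQUALITY
  `ord_p #Ш(E) = ord_p #Ш(E)_an = 2k`, `ord_p #Ш(Wd) = 0`: `BSD(E,p)` and (odd `d_K`, Tamagawa
  transport) `BSD(E^{d_K},p)`.
`k = 0` recovers gen 10 (the certificate is vacuous: `p^0 ∣ #Ш`). `k = 1`: ONE nonzero `x ∈ Ш(E/ℚ)`
with `px = 0` (a `p`-descent: `dim Sel_p(E) ≥ 2` at a rank-one curve with `E(ℚ)[p] = 0`).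
* §1 data level (any level-`N` datum, `p ∤ c(Dt)`, `p ∤ w_K`, `ord_p u(Cd) = 0`):
  `missingPPartAt_and_twist_of_indexValuation_of_pow_dvd` (`MissingPPartAt W p ∧ ord_p #Ш(Wd) = 0`).
* §2 conductor level, `p ∣ N_E` odd, `d_K < −4`: pair alone (`…_of_pow_dvd_of_dvd`); pair AND twist
  for odd `d_K` (`bsdp_and_bsdp_twist_of_indexValuation_of_pow_dvd_of_odd`).
* §3 readings for this sub-cell: `ClassX4M.bsdp_rankOne_of_indexValuation_of_pow_dvd_of_surj`,
  `…_of_not_dvd_padicValRat_j`, and the `k = 1` element form `…_of_exists_torsion_of_surj`.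

Per pair; nothing booked; class-agnostic (X4 any additive type, X7, X8, X11b at `p = 3` alike).
References: [McCallumLMS1991] §1; [GrossLMS1991] Thm. 1.3; [Kolyvagin1990] Thm. A; [Cassels1962ArithmeticIV];
[SilvermanAEC2009] Thm. X.4.14; [JetchevSkinnerWan2017] §7.4; [GrossZagier1986], [CaiShuTian2014];
[Miller2011LMS] §1, Def. 1.1; [SilvermanATAEC1994] IV.9.4 Table 4.1 (type `I₀*`).
-/

noncomputable section

open scoped Classical NumberField

open WeierstrassCurve NumberField Literature.NumberTheory.EllipticCurves
  Literature.NumberTheory.EllipticCurves.ModularForms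
  Literature.NumberTheory.EllipticCurves.Rank1Residual
  Literature.NumberTheory.EllipticCurves.Rank1Residual.Typed
  Literature.NumberTheory.EllipticCurves.KrizLi2019
  Literature.NumberTheory.QuadraticFields
  Literature.NumberTheory.Automorphic
  IsDedekindDomain

namespace Summit.BirchSwinnertonDyer.Rank1Residual.AdditivePotMult

/-! ### §1 Data level, any odd `p`, any level: index valuation `≤ k` + `p^{2k-1} ∣ #Ш(E)` -/

/-- **Rank one, ANY odd `p`, `ρ̄_{E,p}` onto, any reduction type: the typed output `MissingPPartAt W p`
(= `ord_p #Ш(E)_an = ord_p #Ш(E)`, `#Ш_an` rational) AND `ord_p #Ш(Wd) = 0` for the Heegner twist,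
from the index VALUATION and a `Ш`-certificate.** Data: `W/ℚ` globally minimal, `ord_{s=1} L(E,s) = 1`;
`K` imaginary quadratic with the Heegner hypothesis for the level `N`; `P ∈ E(K)` the Heegner point of
a parametrisation datum `Dt` with `p ∤ c(Dt)`; `p ∤ #𝓞_K^×`; `Wd = Cd • W^{(d_K)}` globally minimal
with `ord_p u(Cd) = 0`; `q_d = L(Wd,1)/Ω(Wd) ≠ 0` with `ord_p q_d = 0`; `p ∤ ∏_ℓ c_ℓ(E)`.
CERTIFICATE: `ord_p [E(K):ℤP] ≤ k` and `p^{2k−1} ∣ #Ш(E/ℚ)`. Proof: the bookkeeping identity gives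
`ord_p #Ш(E)_an = 2·ord_p [E(K):ℤP] ≤ 2k` and `ord_p #Ш(E/K) = ord_p #Ш(E) + ord_p #Ш(Wd)`;
Kolyvagin (`hB`) gives `ord_p #Ш(E/K) ≤ 2·ord_p [E(K):ℤP]`; Cassels–Tate (`hCT`) and the certificate
give `2k ≤ ord_p #Ш(E)`. Per pair; nothing booked.
[cite: McCallumLMS1991, §1 Theorem (Kolyvagin), p. 296] [cite: SilvermanAEC2009, Thm. X.4.14]
[cite: JetchevSkinnerWan2017, §7.4.1 (eq:gz for K′), p. 30] [cite: Miller2011LMS, §1 and Def. 1.1] -/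
theorem missingPPartAt_and_twist_of_indexValuation_of_pow_dvd
    (W : WeierstrassCurve ℚ) [W.IsElliptic] [W.IsGloballyMinimal] (p : ℕ) [Fact p.Prime]
    (N : ℕ) [NeZero N] (K : Type) [Field K] [NumberField K]
    (Dt : ModularParametrizationData W N) (H : HeegnerDatum N (NumberField.discr K)) (ι : K →+* ℂ)
    (P : (W.baseChange K).toAffine.Point)
    -- the published inputs (named facts of the tree)
    (hGZ : gross_zagier N W K) (hKo : kolyvagin N W K)
    (hB : Kolyvagin1990_padicValNat_card_sha_le N W K)
    (hGZK : rank_eq_analyticRank_of_analyticRank_le_one) (hmod : hasEntireLFunction_rat)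
    (hCT : exists_casselsTate_pairing (K := ℚ))
    -- the pair and the Heegner data
    (hK : IsImaginaryQuadratic K) (hHN : SatisfiesHeegnerHypothesis N K)
    (hP : WeierstrassCurve.Affine.Point.map ι.toRatAlgHom P = heegnerPointComplex Dt H)
    (hp2 : p ≠ 2) (hc : ¬ (p : ℤ) ∣ Dt.c) (hμ : ¬ p ∣ Units.torsionOrder K)
    (hr : W.analyticRank = 1) (hsurj : Surj W p)
    (Wd : WeierstrassCurve ℚ) [Wd.IsElliptic] [Wd.IsGloballyMinimal] (Cd : VariableChange ℚ)
    (hWd : Cd • W.quadraticTwist (NumberField.discr K : ℚ) = Wd)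
    (hu : padicValRat p (Cd.u : ℚ) = 0)
    -- the twist's algebraic central value (a datum), a `p`-unit
    (qd : ℚ) (hqd : Wd.entireLFunction 1 / (Wd.realPeriodRat : ℂ) = (qd : ℂ)) (hqd0 : qd ≠ 0)
    (hvd : padicValRat p qd = 0) (htam : ¬ p ∣ W.tamagawaProduct)
    -- the certificate: index valuation `≤ k` and `p^{2k-1} ∣ #Ш(E/ℚ)`
    {k : ℕ} (hI : padicValNat p (AddSubgroup.zmultiples P).index ≤ k)
    (hdvd : p ^ (2 * k - 1) ∣ W.shaOrder) :
    MissingPPartAt W p ∧ padicValNat p Wd.shaOrder = 0 := by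
  have hp : p.Prime := Fact.out
  have hirr : Irr W p := hasIrreducibleModPGaloisRep_of_hasSurjectiveModNGaloisRep W p hsurj
  have hD0 : (NumberField.discr K : ℚ) ≠ 0 := by exact_mod_cast NumberField.discr_ne_zero K
  haveI hEt : (W.quadraticTwist (NumberField.discr K : ℚ)).IsElliptic :=
    W.isElliptic_quadraticTwist hD0
  -- the twist's central value is non-zero
  have hLt' : (W.quadraticTwist (NumberField.discr K : ℚ)).entireLFunction = Wd.entireLFunction := by
    rw [← hWd, entireLFunction_smul]
  have hLt : (W.quadraticTwist (NumberField.discr K : ℚ)).entireLFunction 1 ≠ 0 := by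
    rw [hLt']
    intro h0
    apply hqd0
    have : ((qd : ℂ)) = 0 := by rw [← hqd, h0, zero_div]
    exact_mod_cast this
  -- the twist has no rational `p`-torsion
  have hirrd : Wd.HasIrreducibleModPGaloisRep p :=
    X11b.hasIrreducibleModPGaloisRep_twist_model W p K hK.1 hirr Cd hWd
  have htors : padicValNat p Wd.torsionOrder = 0 :=
    padicValNat_torsionOrder_eq_zero_of_irreducible Wd p hirrd
  -- the identity: finiteness, the `Ш` decomposition over `K`, and the valuation of `#Ш_an`
  obtain ⟨hfinW, hfinK, hsum, q, hq, hid⟩ :=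
    X11b.exists_shaAn_padicVal_eq_of_heegner W p N K Dt H ι P hGZ hKo hGZK hmod hK hHN hP hp2 hc hμ
      hr hLt Wd Cd hWd hu qd hqd
  rw [hvd, htors, padicValNat.eq_zero_of_not_dvd htam] at hid
  -- `ord_p #Ш_an(E) = 2 ord_p [E(K):ℤP]`
  have hvq : padicValRat p q = 2 * (padicValNat p (AddSubgroup.zmultiples P).index : ℤ) := by
    have := hid; push_cast at this ⊢; linarith
  -- the Heegner point is non-torsion; Kolyvagin's bound
  have hPH : IsHeegnerPoint N W K P := ⟨Dt, H, ι, hP⟩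
  have hL0 : W.entireLFunction 1 = 0 := entireLFunction_one_eq_zero_of_analyticRank_eq_one hr
  obtain ⟨-, hderiv⟩ := leadingLCoeff_eq_deriv_of_analyticRank_eq_one hr
  have hLK : LDerivEK W K ≠ 0 := by
    rw [lDerivEK_eq_deriv_mul W K hmod hL0]
    exact mul_ne_zero hderiv hLt
  have hnt : ¬ IsOfFinAddOrder P :=
    (lDerivEK_ne_zero_iff_not_isOfFinAddOrder W N K hGZ hK hHN hPH).mp hLK
  have hKsha : padicValNat p (W.baseChange K).shaOrder ≤
      2 * padicValNat p (AddSubgroup.zmultiples P).index := hB hK hHN hPH hnt hp hp2 hsurj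
  -- Cassels–Tate squareness and the certificate: `2k ≤ ord_p #Ш(E)`
  have hfin : W.ShaFinite := hfinW
  have hsq : IsSquare W.shaOrder := isSquare_shaOrder_of_casselsTate hCT W hfin
  have hn : W.shaOrder ≠ 0 := (WeierstrassCurve.shaOrder_pos W hfin).ne'
  have hle : 2 * k ≤ padicValNat p W.shaOrder :=
    two_mul_le_padicValNat_of_isSquare_of_pow_dvd hsq hn hdvd
  -- assembly: `ord_p #Ш(E) + ord_p #Ш(Wd) ≤ 2 ord_p I ≤ 2k ≤ ord_p #Ш(E)`
  have he : padicValNat p W.shaOrder = 2 * padicValNat p (AddSubgroup.zmultiples P).index := by omega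
  have hf : padicValNat p Wd.shaOrder = 0 := by omega
  refine ⟨⟨q, hq, ?_⟩, hf⟩
  rw [hvq, he]
  push_cast
  ring

/-! ### §2 Conductor level, `p ∣ N_E` odd, `d_K < -4` -/

/-- **Rank one, ANY odd `p ∣ N_E` (additive included), `ρ̄_{E,p}` onto, any Heegner field with
`d_K < −4`: `BSD(E,p)` from the index valuation `≤ k` and the certificate `p^{2k−1} ∣ #Ш(E/ℚ)`**
(`ord_p u(Cd) = 0` for the minimal twist model because `p ∣ N_E` splits in `K`; `p ∤ w_K = 2`).
CERTIFICATE: `q_d = L(E^{d_K},1)/Ω(Wd) ≠ 0` with `ord_p q_d = 0`, `p ∤ ∏_ℓ c_ℓ(E)`, `p ∤ c(Dt)`,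
`ord_p [E(K):ℤP] ≤ k`, `p^{2k−1} ∣ #Ш(E)`. No parity condition on `d_K`. Per pair; nothing booked.
[cite: McCallumLMS1991, §1 Theorem (Kolyvagin), p. 296] [cite: SilvermanAEC2009, Thm. X.4.14]
[cite: JetchevSkinnerWan2017, §7.4.1 (eq:gz for K′)] [cite: Miller2011LMS, Def. 1.1] -/
theorem bsdp_of_rankOne_of_indexValuation_of_pow_dvd_of_dvd
    (W : WeierstrassCurve ℚ) [W.IsElliptic] [W.IsGloballyMinimal] (p : ℕ) [Fact p.Prime]
    [NeZero (W.conductorNorm ℤ)] (K : Type) [Field K] [NumberField K]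
    (Dt : ModularParametrizationData W (W.conductorNorm ℤ))
    (H : HeegnerDatum (W.conductorNorm ℤ) (NumberField.discr K)) (ι : K →+* ℂ)
    (P : (W.baseChange K).toAffine.Point)
    (hGZ : gross_zagier (W.conductorNorm ℤ) W K) (hKo : kolyvagin (W.conductorNorm ℤ) W K)
    (hB : Kolyvagin1990_padicValNat_card_sha_le (W.conductorNorm ℤ) W K)
    (hGZK : rank_eq_analyticRank_of_analyticRank_le_one) (hmod : hasEntireLFunction_rat)
    (hCT : exists_casselsTate_pairing (K := ℚ))
    (hp2 : p ≠ 2) (hpN : p ∣ W.conductorNorm ℤ) (hr : W.analyticRank = 1) (hsurj : Surj W p)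
    (hK : IsImaginaryQuadratic K) (hHN : SatisfiesHeegnerHypothesis (W.conductorNorm ℤ) K)
    (hdK : NumberField.discr K < -4)
    (hP : WeierstrassCurve.Affine.Point.map ι.toRatAlgHom P = heegnerPointComplex Dt H)
    (hc : ¬ (p : ℤ) ∣ Dt.c)
    (Wd : WeierstrassCurve ℚ) [Wd.IsElliptic] [Wd.IsGloballyMinimal] (Cd : VariableChange ℚ)
    (hWd : Cd • W.quadraticTwist (NumberField.discr K : ℚ) = Wd)
    (qd : ℚ) (hqd : Wd.entireLFunction 1 / (Wd.realPeriodRat : ℂ) = (qd : ℂ)) (hqd0 : qd ≠ 0)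
    (hvd : padicValRat p qd = 0) (htam : ¬ p ∣ W.tamagawaProduct)
    {k : ℕ} (hI : padicValNat p (AddSubgroup.zmultiples P).index ≤ k)
    (hdvd : p ^ (2 * k - 1) ∣ W.shaOrder) : BSDp W p := by
  have hp : p.Prime := Fact.out
  have hμ : ¬ p ∣ Units.torsionOrder K := by
    rw [Literature.NumberTheory.DiophantineGeometry.torsionOrder_eq_two_of_discr_lt hK.1 hdK]
    intro h2
    exact hp2 ((Nat.prime_dvd_prime_iff_eq hp Nat.prime_two).mp h2)
  have hu : padicValRat p (Cd.u : ℚ) = 0 :=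
    padicValRat_u_eq_zero_of_twist_minimal_of_dvd W p K hK hHN hpN Cd hWd
  exact bsdp_of_missingPPartAt W p hGZK (by rw [hr])
    (missingPPartAt_and_twist_of_indexValuation_of_pow_dvd W p (W.conductorNorm ℤ) K Dt H ι P hGZ hKo
      hB hGZK hmod hCT hK hHN hP hp2 hc hμ hr hsurj Wd Cd hWd hu qd hqd hqd0 hvd htam hI hdvd).1

/-- **Rank one, ANY odd `p ∣ N_E`, `ρ̄_{E,p}` onto, Heegner field with `d_K` ODD and `d_K < −4`: the
index valuation `≤ k` and the certificate `p^{2k−1} ∣ #Ш(E/ℚ)` close BOTH the pair and its rank-zero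
Heegner twist at `p`** — `BSDp W p ∧ BSDp Wd p`. The twist: §1 gives `ord_p #Ш(Wd) = 0`;
eisenstein-p2's odd-`d_K` Tamagawa transport `X2.padicValNat_tamagawaProduct_twist_of_heegner_of_odd`
(type `I₀*` at `ℓ ∣ d_K`; `p ∤ d_K` because `p ∣ N_E` splits in `K`) gives `p ∤ ∏c_ℓ(Wd)`; the twist
inherits irreducibility, so no rational `p`-torsion; the rank-zero print shape
(`bsdp_of_pPartRankZero`) finishes with `ord_p q_d = 0`. `k = 0` is gen 10's
`bsdp_and_bsdp_twist_of_indexCertificate_of_odd`. Per pair; nothing booked; class-agnostic.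
[cite: McCallumLMS1991, §1 Theorem (Kolyvagin), p. 296] [cite: SilvermanAEC2009, Thm. X.4.14]
[cite: JetchevSkinnerWan2017, §7.4 (pp. 29–31)] [cite: SilvermanATAEC1994, IV.9.4 Table 4.1]
[cite: Miller2011LMS, Def. 1.1] -/
theorem bsdp_and_bsdp_twist_of_indexValuation_of_pow_dvd_of_odd
    (W : WeierstrassCurve ℚ) [W.IsElliptic] [W.IsGloballyMinimal] (p : ℕ) [Fact p.Prime]
    [NeZero (W.conductorNorm ℤ)] (K : Type) [Field K] [NumberField K]
    (Dt : ModularParametrizationData W (W.conductorNorm ℤ))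
    (H : HeegnerDatum (W.conductorNorm ℤ) (NumberField.discr K)) (ι : K →+* ℂ)
    (P : (W.baseChange K).toAffine.Point)
    -- the published inputs (named facts of the tree)
    (hGZ : gross_zagier (W.conductorNorm ℤ) W K) (hKo : kolyvagin (W.conductorNorm ℤ) W K)
    (hB : Kolyvagin1990_padicValNat_card_sha_le (W.conductorNorm ℤ) W K)
    (hGZK : rank_eq_analyticRank_of_analyticRank_le_one) (hmod : hasEntireLFunction_rat)
    (hCT : exists_casselsTate_pairing (K := ℚ))
    -- the pair and the Heegner data
    (hp2 : p ≠ 2) (hpN : p ∣ W.conductorNorm ℤ) (hr : W.analyticRank = 1) (hsurj : Surj W p)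
    (hK : IsImaginaryQuadratic K) (hHN : SatisfiesHeegnerHypothesis (W.conductorNorm ℤ) K)
    (hodd : Odd (NumberField.discr K)) (hdK : NumberField.discr K < -4)
    (hP : WeierstrassCurve.Affine.Point.map ι.toRatAlgHom P = heegnerPointComplex Dt H)
    (hc : ¬ (p : ℤ) ∣ Dt.c)
    (Wd : WeierstrassCurve ℚ) [Wd.IsElliptic] [Wd.IsGloballyMinimal] (Cd : VariableChange ℚ)
    (hWd : Cd • W.quadraticTwist (NumberField.discr K : ℚ) = Wd)
    -- the twist value (a `p`-unit), `p ∤ ∏c`, and the certificate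
    (qd : ℚ) (hqd : Wd.entireLFunction 1 / (Wd.realPeriodRat : ℂ) = (qd : ℂ)) (hqd0 : qd ≠ 0)
    (hvd : padicValRat p qd = 0) (htam : ¬ p ∣ W.tamagawaProduct)
    {k : ℕ} (hI : padicValNat p (AddSubgroup.zmultiples P).index ≤ k)
    (hdvd : p ^ (2 * k - 1) ∣ W.shaOrder) :
    BSDp W p ∧ BSDp Wd p := by
  have hp : p.Prime := Fact.out
  have hirr : Irr W p := hasIrreducibleModPGaloisRep_of_hasSurjectiveModNGaloisRep W p hsurj
  -- `w_K = 2`, prime to the odd `p`; `ord_p u = 0`; `p ∤ d_K`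
  have hμ : ¬ p ∣ Units.torsionOrder K := by
    rw [Literature.NumberTheory.DiophantineGeometry.torsionOrder_eq_two_of_discr_lt hK.1 hdK]
    intro h2
    exact hp2 ((Nat.prime_dvd_prime_iff_eq hp Nat.prime_two).mp h2)
  have hu : padicValRat p (Cd.u : ℚ) = 0 :=
    padicValRat_u_eq_zero_of_twist_minimal_of_dvd W p K hK hHN hpN Cd hWd
  have hpd : ¬ (p : ℤ) ∣ NumberField.discr K :=
    Literature.SatisfiesHeegnerHypothesis.not_dvd_discr hK.1 hHN hp hpN
  obtain ⟨hmiss, hshad⟩ :=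
    missingPPartAt_and_twist_of_indexValuation_of_pow_dvd W p (W.conductorNorm ℤ) K Dt H ι P hGZ hKo hB
      hGZK hmod hCT hK hHN hP hp2 hc hμ hr hsurj Wd Cd hWd hu qd hqd hqd0 hvd htam hI hdvd
  refine ⟨bsdp_of_missingPPartAt W p hGZK (by rw [hr]) hmiss, ?_⟩
  ---------------------------------------------------------------- the twist
  have hD0 : (NumberField.discr K : ℚ) ≠ 0 := by exact_mod_cast NumberField.discr_ne_zero K
  haveI hEt : (W.quadraticTwist (NumberField.discr K : ℚ)).IsElliptic :=
    W.isElliptic_quadraticTwist hD0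
  have hLt' : (W.quadraticTwist (NumberField.discr K : ℚ)).entireLFunction = Wd.entireLFunction := by
    rw [← hWd, entireLFunction_smul]
  have hLd1 : Wd.entireLFunction 1 ≠ 0 := by
    intro h0
    apply hqd0
    have : ((qd : ℂ)) = 0 := by rw [← hqd, h0, zero_div]
    exact_mod_cast this
  have hrd : Wd.analyticRank = 0 := (Wd.analyticRank_eq_zero_iff_holds (hmod Wd)).2 hLd1
  have hirrd : Wd.HasIrreducibleModPGaloisRep p :=
    X11b.hasIrreducibleModPGaloisRep_twist_model W p K hK.1 hirr Cd hWd
  have htors : padicValNat p Wd.torsionOrder = 0 :=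
    padicValNat_torsionOrder_eq_zero_of_irreducible Wd p hirrd
  have htamd : padicValNat p Wd.tamagawaProduct = 0 := by
    rw [X2.padicValNat_tamagawaProduct_twist_of_heegner_of_odd W p hp2 K hK hodd hpd hHN Cd hWd]
    exact padicValNat.eq_zero_of_not_dvd htam
  -- the rank-zero print shape for the twist
  refine bsdp_of_pPartRankZero Wd p hmod hGZK hrd ⟨qd, hqd, ?_⟩
  rw [hvd, hshad, htamd, htors]
  simp

/-! ### §3 This sub-cell: X4(M) rank-one pairs at every odd `p` (`p = 3` included) -/

variable {W : WeierstrassCurve ℚ} [W.IsElliptic] {p : ℕ} [Fact p.Prime]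

/-- **X4(M) ∧ surj(p), rank one, ANY odd `p`: `BSD(E,p)` and `BSD(E^{d_K},p)` from the index
valuation `≤ k` at a Heegner field with odd `d_K < −4`, the unit twist value, `p ∤ ∏c_ℓ(E)` and the
certificate `p^{2k−1} ∣ #Ш(E/ℚ)`** (`p ∣ N_E` because `p` is additive). Target: the beyond-window
lane-residue rank-one X4(M) pairs at `p = 3` with `#Ш_an(E) = 9` (19 pairs, census-g12; `k = 1`).
Per pair; X4(M) stays CONSTRUCTION-SHAPED; nothing booked.
[cite: McCallumLMS1991, §1 Theorem (Kolyvagin), p. 296] [cite: SilvermanAEC2009, Thm. X.4.14]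
[cite: Miller2011LMS, Def. 1.1] -/
theorem ClassX4M.bsdp_rankOne_of_indexValuation_of_pow_dvd_of_surj [W.IsGloballyMinimal]
    [NeZero (W.conductorNorm ℤ)]
    (hX : ClassX4M W p) (hr : W.analyticRank = 1) (hsurj : Surj W p)
    (K : Type) [Field K] [NumberField K]
    (Dt : ModularParametrizationData W (W.conductorNorm ℤ))
    (H : HeegnerDatum (W.conductorNorm ℤ) (NumberField.discr K)) (ι : K →+* ℂ)
    (P : (W.baseChange K).toAffine.Point)
    (hGZ : gross_zagier (W.conductorNorm ℤ) W K) (hKo : kolyvagin (W.conductorNorm ℤ) W K)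
    (hB : Kolyvagin1990_padicValNat_card_sha_le (W.conductorNorm ℤ) W K)
    (hGZK : rank_eq_analyticRank_of_analyticRank_le_one) (hmod : hasEntireLFunction_rat)
    (hCT : exists_casselsTate_pairing (K := ℚ))
    (hK : IsImaginaryQuadratic K) (hHN : SatisfiesHeegnerHypothesis (W.conductorNorm ℤ) K)
    (hodd : Odd (NumberField.discr K)) (hdK : NumberField.discr K < -4)
    (hP : WeierstrassCurve.Affine.Point.map ι.toRatAlgHom P = heegnerPointComplex Dt H)
    (hc : ¬ (p : ℤ) ∣ Dt.c)
    (Wd : WeierstrassCurve ℚ) [Wd.IsElliptic] [Wd.IsGloballyMinimal] (Cd : VariableChange ℚ)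
    (hWd : Cd • W.quadraticTwist (NumberField.discr K : ℚ) = Wd)
    (qd : ℚ) (hqd : Wd.entireLFunction 1 / (Wd.realPeriodRat : ℂ) = (qd : ℂ)) (hqd0 : qd ≠ 0)
    (hvd : padicValRat p qd = 0) (htam : ¬ p ∣ W.tamagawaProduct)
    {k : ℕ} (hI : padicValNat p (AddSubgroup.zmultiples P).index ≤ k)
    (hdvd : p ^ (2 * k - 1) ∣ W.shaOrder) :
    BSDp W p ∧ BSDp Wd p :=
  have hpN : p ∣ W.conductorNorm ℤ :=
    (W.dvd_conductorNorm_iff_not_hasGoodReductionAtPrime p).mpr (not_good_of_addv W p hX.1.2.1)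
  bsdp_and_bsdp_twist_of_indexValuation_of_pow_dvd_of_odd W p K Dt H ι P hGZ hKo hB hGZK hmod hCT
    hX.p_ne_two hpN hr hsurj hK hHN hodd hdK hP hc Wd Cd hWd qd hqd hqd0 hvd htam hI hdvd

/-- **X4(M) ∧ `p ∤ ord_p j(E)`, rank one, ANY odd `p`: the image hypothesis DISCHARGED** (multr1-p2's
`ClassX4M.surj_of_not_dvd_padicValRat_j`), so `BSD(E,p)` and `BSD(E^{d_K},p)` follow from the finite
certificate (index valuation `≤ k`, unit twist value, `p ∤ ∏c_ℓ(E)`, `p^{2k−1} ∣ #Ш(E)`) and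
PUBLISHED facts alone. Per pair; nothing booked. [cite: SilvermanATAEC1994, V.6 Prop. 6.1 (p. 410) and V.5.3]
[cite: McCallumLMS1991, §1 Theorem (Kolyvagin), p. 296] [cite: SilvermanAEC2009, Thm. X.4.14] -/
theorem ClassX4M.bsdp_rankOne_of_indexValuation_of_pow_dvd_of_not_dvd_padicValRat_j
    [W.IsGloballyMinimal] [NeZero (W.conductorNorm ℤ)]
    (hX : ClassX4M W p) (hr : W.analyticRank = 1) (hj : ¬ (p : ℤ) ∣ padicValRat p W.j)
    (K : Type) [Field K] [NumberField K]
    (Dt : ModularParametrizationData W (W.conductorNorm ℤ))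
    (H : HeegnerDatum (W.conductorNorm ℤ) (NumberField.discr K)) (ι : K →+* ℂ)
    (P : (W.baseChange K).toAffine.Point)
    (hGZ : gross_zagier (W.conductorNorm ℤ) W K) (hKo : kolyvagin (W.conductorNorm ℤ) W K)
    (hB : Kolyvagin1990_padicValNat_card_sha_le (W.conductorNorm ℤ) W K)
    (hGZK : rank_eq_analyticRank_of_analyticRank_le_one) (hmod : hasEntireLFunction_rat)
    (hCT : exists_casselsTate_pairing (K := ℚ))
    (hK : IsImaginaryQuadratic K) (hHN : SatisfiesHeegnerHypothesis (W.conductorNorm ℤ) K)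
    (hodd : Odd (NumberField.discr K)) (hdK : NumberField.discr K < -4)
    (hP : WeierstrassCurve.Affine.Point.map ι.toRatAlgHom P = heegnerPointComplex Dt H)
    (hc : ¬ (p : ℤ) ∣ Dt.c)
    (Wd : WeierstrassCurve ℚ) [Wd.IsElliptic] [Wd.IsGloballyMinimal] (Cd : VariableChange ℚ)
    (hWd : Cd • W.quadraticTwist (NumberField.discr K : ℚ) = Wd)
    (qd : ℚ) (hqd : Wd.entireLFunction 1 / (Wd.realPeriodRat : ℂ) = (qd : ℂ)) (hqd0 : qd ≠ 0)
    (hvd : padicValRat p qd = 0) (htam : ¬ p ∣ W.tamagawaProduct)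
    {k : ℕ} (hI : padicValNat p (AddSubgroup.zmultiples P).index ≤ k)
    (hdvd : p ^ (2 * k - 1) ∣ W.shaOrder) :
    BSDp W p ∧ BSDp Wd p :=
  ClassX4M.bsdp_rankOne_of_indexValuation_of_pow_dvd_of_surj hX hr
    (ClassX4M.surj_of_not_dvd_padicValRat_j hX hj) K Dt H ι P hGZ hKo hB hGZK hmod hCT hK hHN hodd hdK
    hP hc Wd Cd hWd qd hqd hqd0 hvd htam hI hdvd

/-- **The `k = 1` element form** (the case of the 19 census-g12 pairs, `#Ш_an(E) = 9`): X4(M) ∧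
surj(p), rank one, any odd `p`; index valuation `≤ 1`, unit twist value, `p ∤ ∏c_ℓ(E)`, and ONE
nonzero `x ∈ Ш(E/ℚ)` with `px = 0` (`Typed.dvd_shaOrder_of_exists_torsion`) ⇒ `BSD(E,p)` and
`BSD(E^{d_K},p)`. Per pair; nothing booked. [cite: McCallumLMS1991, §1 Theorem (Kolyvagin), p. 296]
[cite: SilvermanAEC2009, Thm. X.4.14] [cite: Miller2011LMS, Def. 1.1] -/
theorem ClassX4M.bsdp_rankOne_of_indexValuation_of_exists_torsion_of_surj [W.IsGloballyMinimal]
    [NeZero (W.conductorNorm ℤ)]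
    (hX : ClassX4M W p) (hr : W.analyticRank = 1) (hsurj : Surj W p)
    (K : Type) [Field K] [NumberField K]
    (Dt : ModularParametrizationData W (W.conductorNorm ℤ))
    (H : HeegnerDatum (W.conductorNorm ℤ) (NumberField.discr K)) (ι : K →+* ℂ)
    (P : (W.baseChange K).toAffine.Point)
    (hGZ : gross_zagier (W.conductorNorm ℤ) W K) (hKo : kolyvagin (W.conductorNorm ℤ) W K)
    (hB : Kolyvagin1990_padicValNat_card_sha_le (W.conductorNorm ℤ) W K)
    (hGZK : rank_eq_analyticRank_of_analyticRank_le_one) (hmod : hasEntireLFunction_rat)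
    (hCT : exists_casselsTate_pairing (K := ℚ))
    (hK : IsImaginaryQuadratic K) (hHN : SatisfiesHeegnerHypothesis (W.conductorNorm ℤ) K)
    (hodd : Odd (NumberField.discr K)) (hdK : NumberField.discr K < -4)
    (hP : WeierstrassCurve.Affine.Point.map ι.toRatAlgHom P = heegnerPointComplex Dt H)
    (hc : ¬ (p : ℤ) ∣ Dt.c)
    (Wd : WeierstrassCurve ℚ) [Wd.IsElliptic] [Wd.IsGloballyMinimal] (Cd : VariableChange ℚ)
    (hWd : Cd • W.quadraticTwist (NumberField.discr K : ℚ) = Wd)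
    (qd : ℚ) (hqd : Wd.entireLFunction 1 / (Wd.realPeriodRat : ℂ) = (qd : ℂ)) (hqd0 : qd ≠ 0)
    (hvd : padicValRat p qd = 0) (htam : ¬ p ∣ W.tamagawaProduct)
    (hI : padicValNat p (AddSubgroup.zmultiples P).index ≤ 1)
    (hx : ∃ x : W.sha, x ≠ 0 ∧ p • x = 0) :
    BSDp W p ∧ BSDp Wd p :=
  ClassX4M.bsdp_rankOne_of_indexValuation_of_pow_dvd_of_surj hX hr hsurj K Dt H ι P hGZ hKo hB hGZK hmod
    hCT hK hHN hodd hdK hP hc Wd Cd hWd qd hqd hqd0 hvd htam (k := 1) hI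
    (by simpa using dvd_shaOrder_of_exists_torsion W p hx)

end Summit.BirchSwinnertonDyer.Rank1Residual.AdditivePotMult

end
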